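import Literature.MathematicalPhysics.QuantumManyBody.TorusFockLayer
import Mathlib.MeasureTheory.Integral.MeanInequalities
import HarnessLib

/-!
# Stability of the condensate occupation: phase invariance and `L²`-Lipschitz continuity

Topic `Literature/MathematicalPhysics/QuantumManyBody`, companion of `PeriodicBoseGas.lean`
(`condensateOccupation`, Fournais's `⟨Ψ, n₀Ψ⟩ = N⟨Ψ, P_{Ω,1}Ψ⟩`) and of `TorusFockLayer.lean`
(`condensateOccupation = ‖a₀Ψ‖²`, `modeAn`). Every argument that transports Bose–Einstein
condensation from ONE state (a minimiser, a limit point of minimisers) to ALL near-minimisers of the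
same variational problem needs two elementary facts about the functional `Ψ ↦ ⟨Ψ, n₀Ψ⟩` on the
`N`-body functions of the cell `Λ^N = [0,L)^{3N}`:

* **phase invariance / homogeneity** — `n₀(cΨ) = |c|² n₀(Ψ)`, in particular
  `n₀(e^{iθ}Ψ) = n₀(Ψ)` (`occupation_const_mul`, `condensateOccupation_const_mul`,
  `condensateOccupation_phase_mul`);
* **`L²`-Lipschitz continuity on the unit ball** — `n₀ = ‖a₀ ·‖²` with `a₀ = √N P` a bounded
  operator (`‖a₀Ψ‖² ≤ N‖Ψ‖²`, `condensateOccupation_le_card_mul_lintegral`, here from Parseval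
  `Σ_k n_k = N‖Ψ‖²`), so `√n₀` is a seminorm (`condensateOccupation_rpow_half_le_add`, Minkowski) and
  `|n₀(Φ) - n₀(Ψ)| ≤ 2N ‖Φ - Ψ‖_{L²(Λ^N)}` for `‖Φ‖, ‖Ψ‖ ≤ 1`
  (`condensateOccupation_le_add_lintegral_rpow`, `abs_toReal_condensateOccupation_sub_le`, and the
  trial-state form modulo a phase `PeriodicTrialState.condensateOccupation_le_add_of_phase_sq_dist_le`).

As the first application, the file proves the **transfer of condensation to near-minimisers under
variational simplicity** (`le_condensateOccupation_nearMinimiser_of_clustering`): if the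
`δ`-near-minimisers of the periodic energy cluster in `L²(Λ^N)` modulo a phase (Cauchy form) and
near-minimisers with `n₀ ≥ cN` exist at every slack, then for every `ε > 0` some `δ > 0` makes every
`δ`-near-minimiser satisfy `n₀ ≥ (c - ε)N`; and its corollary for the bounded truncations
`min(v, n)` of a BOUNDED potential (`truncationTransfer_of_bounded`), where the truncation is
eventually `v` itself. (For unbounded / hard-core `v` the same transfer needs Rellich compactness on
the torus and monotone convergence of closed forms, which are not in Mathlib.)

All statements are for continuous functions on the cell (periodic trial states are `C¹`), with the
`ℝ≥0∞` conventions of `PeriodicBoseGas.lean`; the real forms are derived at the end of each section.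

## References

* [LSSY2005] E. H. Lieb, R. Seiringer, J. P. Solovej, J. Yngvason, *The Mathematics of the Bose Gas
  and its Condensation*, Oberwolfach Seminars 34, Birkhäuser 2005: §1.2 (1.17) (`⟨φ, γ_Ψ φ⟩`),
  App. A (A.11), (A.13) (`a(φ)`, `Σ a†a = N`).
* [Fournais2020] S. Fournais, *Length scales for BEC in the dilute Bose gas*, arXiv:2011.00309:
  (1.3)–(1.5) (`n₀ = Σⱼ P_{Ω,j}`, `n₊ = N - n₀`).
-/

noncomputable section

open MeasureTheory Filter
open scoped ENNReal NNReal ComplexConjugate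

namespace Literature.MathematicalPhysics.QuantumManyBody.BoseGas

/-! ### Homogeneity and phase invariance -/

section Phase

/-- `(‖c z‖₊)² = (‖c‖₊)² (‖z‖₊)²` in `ℝ≥0∞`. [folklore] -/
theorem coe_nnnorm_mul_sq (c z : ℂ) :
    ((‖c * z‖₊ : ℝ≥0∞) ^ 2) = (‖c‖₊ : ℝ≥0∞) ^ 2 * (‖z‖₊ : ℝ≥0∞) ^ 2 := by
  rw [nnnorm_mul, ENNReal.coe_mul, mul_pow]

/-- A phase has `(‖e^{iθ}‖₊)² = 1` in `ℝ≥0∞`. [folklore] -/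
theorem coe_nnnorm_exp_mul_I_sq (θ : ℝ) :
    ((‖Complex.exp (θ * Complex.I)‖₊ : ℝ≥0∞) ^ 2) = 1 := by
  rw [← enorm_eq_nnnorm, ← ofReal_norm, Complex.norm_exp_ofReal_mul_I]
  simp

/-- **Homogeneity of the occupation of a mode**: `⟨φ, γ_{cΨ} φ⟩ = |c|² ⟨φ, γ_Ψ φ⟩`
(the one-particle density matrix is quadratic in `Ψ`). [cite: LSSY2005, §1.2 (1.17)] -/
theorem occupation_const_mul (N : ℕ) (φ : Space → ℂ) (c : ℂ) (Ψ : Config N → ℂ) :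
    occupation N φ (fun X => c * Ψ X) = (‖c‖₊ : ℝ≥0∞) ^ 2 * occupation N φ Ψ := by
  cases N with
  | zero => simp [occupation]
  | succ n =>
    unfold occupation
    have h : ∀ Y : Config n, (∫ x, conj (φ x) * (c * Ψ (Matrix.vecCons x Y))) =
        c * ∫ x, conj (φ x) * Ψ (Matrix.vecCons x Y) := fun Y => by
      rw [← integral_const_mul]
      congr 1
      funext x
      ring
    simp only [h, coe_nnnorm_mul_sq]
    rw [lintegral_const_mul' _ _ (ENNReal.pow_ne_top ENNReal.coe_ne_top)]
    ring

/-- **Homogeneity of the condensate occupation**: `n₀(cΨ) = |c|² n₀(Ψ)`. [cite: Fournais2020, (1.3)–(1.5)] -/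
theorem condensateOccupation_const_mul (N : ℕ) (L : ℝ) (c : ℂ) (Ψ : Config N → ℂ) :
    condensateOccupation N L (fun X => c * Ψ X) = (‖c‖₊ : ℝ≥0∞) ^ 2 * condensateOccupation N L Ψ := by
  unfold condensateOccupation
  have h : (cellN N L).indicator (fun X => c * Ψ X) = fun X => c * (cellN N L).indicator Ψ X := by
    funext X
    by_cases hX : X ∈ cellN N L <;> simp [hX]
  rw [h, occupation_const_mul]

/-- **Phase invariance of the condensate occupation**: `n₀(cΨ) = n₀(Ψ)` for `|c| = 1`.
[cite: Fournais2020, (1.3)–(1.5)] -/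
theorem condensateOccupation_const_mul_of_norm_eq_one (N : ℕ) (L : ℝ) {c : ℂ} (hc : ‖c‖ = 1)
    (Ψ : Config N → ℂ) :
    condensateOccupation N L (fun X => c * Ψ X) = condensateOccupation N L Ψ := by
  have h1 : ((‖c‖₊ : ℝ≥0∞) ^ 2) = 1 := by
    rw [← enorm_eq_nnnorm, ← ofReal_norm, hc]
    simp
  rw [condensateOccupation_const_mul, h1, one_mul]

/-- **Phase invariance of the condensate occupation**: `n₀(e^{iθ}Ψ) = n₀(Ψ)`.
[cite: Fournais2020, (1.3)–(1.5)] -/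
theorem condensateOccupation_phase_mul (N : ℕ) (L : ℝ) (θ : ℝ) (Ψ : Config N → ℂ) :
    condensateOccupation N L (fun X => Complex.exp (θ * Complex.I) * Ψ X) =
      condensateOccupation N L Ψ := by
  rw [condensateOccupation_const_mul, coe_nnnorm_exp_mul_I_sq, one_mul]

end Phase

/-! ### `L²`-Lipschitz continuity of `n₀ = ‖a₀ ·‖²` on the unit ball -/

section Lipschitz

variable {L : ℝ}

/-- `a(φ)Ψ` is measurable for a measurable mode and a measurable `N`-body function. [folklore] -/
theorem measurable_modeAn (L : ℝ) {φ : Space → ℂ} (hφ : Measurable φ) {n : ℕ}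
    {Ψ : Config (n + 1) → ℂ} (hΨ : Measurable Ψ) : Measurable (modeAn L φ Ψ) := by
  have h : StronglyMeasurable (Function.uncurry fun (Y : Config n) (x : Space) =>
      conj (φ x) * Ψ (Matrix.vecCons x Y)) := by
    refine Measurable.stronglyMeasurable ?_
    exact (Complex.continuous_conj.measurable.comp (hφ.comp measurable_snd)).mul
      (hΨ.comp (continuous_snd.matrixVecCons continuous_fst).measurable)
  have h2 : StronglyMeasurable fun Y : Config n =>
      ∫ x in cell L, conj (φ x) * Ψ (Matrix.vecCons x Y) :=
    h.integral_prod_right' (ν := volume.restrict (cell L))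
  unfold modeAn
  exact h2.measurable.const_mul _

/-- The constant mode is measurable. [folklore] -/
theorem measurable_constantMode (L : ℝ) : Measurable (constantMode L) :=
  measurable_const.indicator (measurableSet_cell L)

/-- The constant mode is bounded by `L^{-3/2}`. [folklore] -/
theorem norm_constantMode_le (L : ℝ) (x : Space) : ‖constantMode L x‖ ≤ |(Real.sqrt (L ^ 3))⁻¹| := by
  rw [← planeWave_zero]
  exact norm_planeWave_le L 0 x

/-- **`a₀` is bounded by `√N`**: `n₀(Ψ) = ‖a₀Ψ‖² ≤ N ∫_{Λ^N} |Ψ|²` for a continuous `N = n+1`-body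
function (the `k = 0` term of Parseval `Σ_k n_k(Ψ) = N‖Ψ‖²`, (A.11)). [cite: LSSY2005, App. A (A.11)] -/
theorem condensateOccupation_le_mul_lintegral {n : ℕ} (hL : 0 < L) {Ψ : Config (n + 1) → ℂ}
    (hΨ : Continuous Ψ) :
    condensateOccupation (n + 1) L Ψ ≤
      (n + 1 : ℝ≥0∞) * ∫⁻ X in cellN (n + 1) L, (‖Ψ X‖₊ : ℝ≥0∞) ^ 2 := by
  rw [← momentumOccupation_zero, ← tsum_momentumOccupation hL hΨ]
  exact ENNReal.le_tsum 0

/-- `n₀(Ψ) ≤ N ∫_{Λ^N} |Ψ|²` for every continuous `N`-body function (also `N = 0`).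
[cite: LSSY2005, App. A (A.11)] -/
theorem condensateOccupation_le_card_mul_lintegral {N : ℕ} (hL : 0 < L) {Ψ : Config N → ℂ}
    (hΨ : Continuous Ψ) :
    condensateOccupation N L Ψ ≤ (N : ℝ≥0∞) * ∫⁻ X in cellN N L, (‖Ψ X‖₊ : ℝ≥0∞) ^ 2 := by
  cases N with
  | zero => simp [condensateOccupation, occupation]
  | succ n =>
    calc condensateOccupation (n + 1) L Ψ
        ≤ (n + 1 : ℝ≥0∞) * ∫⁻ X in cellN (n + 1) L, (‖Ψ X‖₊ : ℝ≥0∞) ^ 2 :=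
          condensateOccupation_le_mul_lintegral hL hΨ
      _ = ((n + 1 : ℕ) : ℝ≥0∞) * ∫⁻ X in cellN (n + 1) L, (‖Ψ X‖₊ : ℝ≥0∞) ^ 2 := by push_cast; rfl

/-- **`√n₀` is a seminorm** on continuous `N`-body functions: `√n₀(Φ) ≤ √n₀(Ψ) + √n₀(Φ - Ψ)`
(`√n₀ = ‖a₀ ·‖_{L²(Λ^{N-1})}`, linearity of `a₀` and Minkowski). [cite: LSSY2005, App. A (A.13)] -/
theorem condensateOccupation_rpow_half_le_add {N : ℕ} (L : ℝ) {Φ Ψ : Config N → ℂ}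
    (hΦ : Continuous Φ) (hΨ : Continuous Ψ) :
    condensateOccupation N L Φ ^ (1 / 2 : ℝ) ≤
      condensateOccupation N L Ψ ^ (1 / 2 : ℝ) +
        condensateOccupation N L (fun X => Φ X - Ψ X) ^ (1 / 2 : ℝ) := by
  cases N with
  | zero => simp [condensateOccupation, occupation]
  | succ n =>
    simp only [condensateOccupation_eq_lintegral_modeAn_constantMode]
    have hφm := measurable_constantMode L
    have hφb := norm_constantMode_le L
    -- linearity of `a₀`
    have hlin : modeAn L (constantMode L) Φ =
        modeAn L (constantMode L) Ψ + modeAn L (constantMode L) (fun X => Φ X - Ψ X) := by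
      rw [← modeAn_add L (constantMode L) Ψ (fun X => Φ X - Ψ X)
        (fun Y => integrableOn_cell_conj_mul hφm hφb (continuous_vecCons_slice hΨ Y))
        (fun Y => integrableOn_cell_conj_mul hφm hφb (continuous_vecCons_slice (hΦ.sub hΨ) Y))]
      congr 1
      funext X
      simp
    -- pointwise triangle inequality
    have hpt : ∀ Y, (‖modeAn L (constantMode L) Φ Y‖₊ : ℝ≥0∞) ≤
        (‖modeAn L (constantMode L) Ψ Y‖₊ : ℝ≥0∞) +
          (‖modeAn L (constantMode L) (fun X => Φ X - Ψ X) Y‖₊ : ℝ≥0∞) := by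
      intro Y
      rw [hlin, Pi.add_apply]
      exact_mod_cast nnnorm_add_le _ _
    -- Minkowski in `L²(Λⁿ)`
    have hmΨ : AEMeasurable (fun Y => (‖modeAn L (constantMode L) Ψ Y‖₊ : ℝ≥0∞))
        (volume.restrict (cellN n L)) :=
      (measurable_modeAn L hφm hΨ.measurable).nnnorm.coe_nnreal_ennreal.aemeasurable
    have hmD : AEMeasurable (fun Y => (‖modeAn L (constantMode L) (fun X => Φ X - Ψ X) Y‖₊ : ℝ≥0∞))
        (volume.restrict (cellN n L)) :=
      (measurable_modeAn L hφm (hΦ.sub hΨ).measurable).nnnorm.coe_nnreal_ennreal.aemeasurable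
    have hmink := ENNReal.lintegral_Lp_add_le (μ := volume.restrict (cellN n L)) hmΨ hmD
      (by norm_num : (1 : ℝ) ≤ 2)
    simp only [Pi.add_apply, ENNReal.rpow_two] at hmink
    refine le_trans ?_ hmink
    gcongr with Y
    exact hpt Y

/-- The algebra of the Lipschitz estimate: `a ≤ b + d ⇒ a² ≤ b² + d(a + b)` in `ℝ≥0∞`. [folklore] -/
theorem sq_le_sq_add_mul_add {a b d : ℝ≥0∞} (h : a ≤ b + d) : a ^ 2 ≤ b ^ 2 + d * (a + b) := by
  rcases le_or_gt a b with hab | hab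
  · calc a ^ 2 ≤ b ^ 2 := by gcongr
      _ ≤ b ^ 2 + d * (a + b) := le_self_add
  · have h1 : b + (a - b) = a := add_tsub_cancel_of_le hab.le
    have h2 : a - b ≤ d := tsub_le_iff_right.2 (by rwa [add_comm])
    calc a ^ 2 = (b + (a - b)) * (b + (a - b)) := by rw [h1, sq]
      _ = b ^ 2 + (a - b) * ((b + (a - b)) + b) := by ring
      _ = b ^ 2 + (a - b) * (a + b) := by rw [h1]
      _ ≤ b ^ 2 + d * (a + b) := by gcongr

/-- The algebra of the Lipschitz estimate, continued: with `a, b ≤ s` and `d ≤ s e`,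
`a² ≤ b² + 2 s² e`. [folklore] -/
theorem sq_le_sq_add_of_le_add {a b d s e : ℝ≥0∞} (habd : a ≤ b + d) (ha : a ≤ s) (hb : b ≤ s)
    (hd : d ≤ s * e) : a ^ 2 ≤ b ^ 2 + 2 * (s * s) * e := by
  calc a ^ 2 ≤ b ^ 2 + d * (a + b) := sq_le_sq_add_mul_add habd
    _ ≤ b ^ 2 + (s * e) * (s + s) := by gcongr
    _ = b ^ 2 + 2 * (s * s) * e := by ring

/-- **`L²`-Lipschitz continuity of the condensate occupation on the unit ball** (`ℝ≥0∞` form):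
for continuous `N`-body functions `Φ, Ψ` with `∫_{Λ^N}|Φ|² ≤ 1`, `∫_{Λ^N}|Ψ|² ≤ 1`,
`n₀(Φ) ≤ n₀(Ψ) + 2N (∫_{Λ^N} |Φ - Ψ|²)^{1/2}`. Proof: `√n₀` is a seminorm bounded by `√N ‖·‖₂`,
and `a² - b² = (a - b)(a + b) ≤ ‖a₀(Φ - Ψ)‖ · 2√N`. [cite: LSSY2005, App. A (A.11), (A.13)] -/
theorem condensateOccupation_le_add_lintegral_rpow {N : ℕ} (hL : 0 < L) {Φ Ψ : Config N → ℂ}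
    (hΦ : Continuous Φ) (hΨ : Continuous Ψ)
    (hΦ1 : ∫⁻ X in cellN N L, (‖Φ X‖₊ : ℝ≥0∞) ^ 2 ≤ 1)
    (hΨ1 : ∫⁻ X in cellN N L, (‖Ψ X‖₊ : ℝ≥0∞) ^ 2 ≤ 1) :
    condensateOccupation N L Φ ≤ condensateOccupation N L Ψ +
      2 * N * (∫⁻ X in cellN N L, (‖Φ X - Ψ X‖₊ : ℝ≥0∞) ^ 2) ^ (1 / 2 : ℝ) := by
  -- `(x^{1/2})² = x` (the tree's `ENNReal.rpow_half_sq` lives in the fluid-PDE Fourier stack)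
  have hsq : ∀ x : ℝ≥0∞, (x ^ (1 / 2 : ℝ)) ^ 2 = x := fun x => by
    rw [← ENNReal.rpow_two, ← ENNReal.rpow_mul]
    norm_num
  have habd := condensateOccupation_rpow_half_le_add L hΦ hΨ
  have hdle : condensateOccupation N L (fun X => Φ X - Ψ X) ^ (1 / 2 : ℝ) ≤
      (N : ℝ≥0∞) ^ (1 / 2 : ℝ) * (∫⁻ X in cellN N L, (‖Φ X - Ψ X‖₊ : ℝ≥0∞) ^ 2) ^ (1 / 2 : ℝ) := by
    rw [← ENNReal.mul_rpow_of_nonneg _ _ (by norm_num)]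
    exact ENNReal.rpow_le_rpow (condensateOccupation_le_card_mul_lintegral hL (hΦ.sub hΨ))
      (by norm_num)
  have hbound : ∀ {F : Config N → ℂ}, Continuous F →
      (∫⁻ X in cellN N L, (‖F X‖₊ : ℝ≥0∞) ^ 2 ≤ 1) →
      condensateOccupation N L F ^ (1 / 2 : ℝ) ≤ (N : ℝ≥0∞) ^ (1 / 2 : ℝ) := by
    intro F hF hF1
    refine ENNReal.rpow_le_rpow ?_ (by norm_num)
    calc condensateOccupation N L F ≤ (N : ℝ≥0∞) * ∫⁻ X in cellN N L, (‖F X‖₊ : ℝ≥0∞) ^ 2 :=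
          condensateOccupation_le_card_mul_lintegral hL hF
      _ ≤ (N : ℝ≥0∞) * 1 := by gcongr
      _ = N := mul_one _
  calc condensateOccupation N L Φ = (condensateOccupation N L Φ ^ (1 / 2 : ℝ)) ^ 2 :=
        (hsq _).symm
    _ ≤ (condensateOccupation N L Ψ ^ (1 / 2 : ℝ)) ^ 2 +
          2 * ((N : ℝ≥0∞) ^ (1 / 2 : ℝ) * (N : ℝ≥0∞) ^ (1 / 2 : ℝ)) *
            (∫⁻ X in cellN N L, (‖Φ X - Ψ X‖₊ : ℝ≥0∞) ^ 2) ^ (1 / 2 : ℝ) :=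
        sq_le_sq_add_of_le_add habd (hbound hΦ hΦ1) (hbound hΨ hΨ1) hdle
    _ = condensateOccupation N L Ψ +
          2 * N * (∫⁻ X in cellN N L, (‖Φ X - Ψ X‖₊ : ℝ≥0∞) ^ 2) ^ (1 / 2 : ℝ) := by
        rw [hsq, ← sq, hsq]

/-- `∫⁻_{Λ^N} ‖F‖₊² = ofReal (∫_{Λ^N} ‖F‖²)` for a continuous `F` (bounded on the bounded cell).
[folklore] -/
theorem lintegral_cellN_nnnorm_sq_eq_ofReal {N : ℕ} (L : ℝ) {F : Config N → ℂ} (hF : Continuous F) :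
    ∫⁻ X in cellN N L, (‖F X‖₊ : ℝ≥0∞) ^ 2 = ENNReal.ofReal (∫ X in cellN N L, ‖F X‖ ^ 2) := by
  have hc : Continuous fun X => ‖F X‖ ^ 2 := hF.norm.pow 2
  rw [ofReal_integral_eq_lintegral_ofReal (integrableOn_cellN hc L)
    (ae_of_all _ fun X => by positivity)]
  simp only [coe_nnnorm_sq_eq_ofReal]

/-- `(ofReal x)^{1/2} = ofReal √x`. [folklore] -/
theorem ofReal_rpow_half_eq_sqrt {x : ℝ} (hx : 0 ≤ x) :
    (ENNReal.ofReal x) ^ (1 / 2 : ℝ) = ENNReal.ofReal (Real.sqrt x) := by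
  rw [Real.sqrt_eq_rpow, ENNReal.ofReal_rpow_of_nonneg hx (by norm_num)]

/-- `2 N ofReal(√η) = ofReal (2 N √η)`. [folklore] -/
theorem two_mul_natCast_mul_ofReal (N : ℕ) (y : ℝ) :
    (2 : ℝ≥0∞) * N * ENNReal.ofReal y = ENNReal.ofReal (2 * N * y) := by
  rw [ENNReal.ofReal_mul (by positivity), ENNReal.ofReal_mul (by norm_num), ENNReal.ofReal_natCast,
    ENNReal.ofReal_ofNat]

/-- **`L²`-Lipschitz continuity of the condensate occupation, real Bochner form**: for continuous
`Φ, Ψ` in the unit ball of `L²(Λ^N)` and `∫_{Λ^N}‖Φ - Ψ‖² ≤ η`,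
`n₀(Φ) ≤ n₀(Ψ) + 2N√η`. [cite: LSSY2005, App. A (A.11), (A.13)] -/
theorem condensateOccupation_le_add_of_sq_dist_le {N : ℕ} (hL : 0 < L) {Φ Ψ : Config N → ℂ}
    (hΦ : Continuous Φ) (hΨ : Continuous Ψ)
    (hΦ1 : ∫⁻ X in cellN N L, (‖Φ X‖₊ : ℝ≥0∞) ^ 2 ≤ 1)
    (hΨ1 : ∫⁻ X in cellN N L, (‖Ψ X‖₊ : ℝ≥0∞) ^ 2 ≤ 1) {η : ℝ}
    (hη : ∫ X in cellN N L, ‖Φ X - Ψ X‖ ^ 2 ≤ η) :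
    condensateOccupation N L Φ ≤ condensateOccupation N L Ψ + ENNReal.ofReal (2 * N * Real.sqrt η) := by
  have hη0 : 0 ≤ η := le_trans (integral_nonneg fun X => by positivity) hη
  calc condensateOccupation N L Φ ≤ condensateOccupation N L Ψ +
        2 * N * (∫⁻ X in cellN N L, (‖Φ X - Ψ X‖₊ : ℝ≥0∞) ^ 2) ^ (1 / 2 : ℝ) :=
        condensateOccupation_le_add_lintegral_rpow hL hΦ hΨ hΦ1 hΨ1
    _ ≤ condensateOccupation N L Ψ + 2 * N * (ENNReal.ofReal η) ^ (1 / 2 : ℝ) := by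
        rw [lintegral_cellN_nnnorm_sq_eq_ofReal L (F := fun X => Φ X - Ψ X) (hΦ.sub hΨ)]
        gcongr
    _ = condensateOccupation N L Ψ + ENNReal.ofReal (2 * N * Real.sqrt η) := by
        rw [ofReal_rpow_half_eq_sqrt hη0, two_mul_natCast_mul_ofReal N (Real.sqrt η)]

/-- `n₀` of a continuous function in the unit ball is finite (`≤ N`). [cite: LSSY2005, App. A (A.11)] -/
theorem condensateOccupation_ne_top_of_lintegral_le_one {N : ℕ} (hL : 0 < L) {Ψ : Config N → ℂ}
    (hΨ : Continuous Ψ) (hΨ1 : ∫⁻ X in cellN N L, (‖Ψ X‖₊ : ℝ≥0∞) ^ 2 ≤ 1) :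
    condensateOccupation N L Ψ ≠ ⊤ := by
  refine ne_top_of_le_ne_top (ENNReal.natCast_ne_top N) ?_
  calc condensateOccupation N L Ψ ≤ (N : ℝ≥0∞) * ∫⁻ X in cellN N L, (‖Ψ X‖₊ : ℝ≥0∞) ^ 2 :=
        condensateOccupation_le_card_mul_lintegral hL hΨ
    _ ≤ (N : ℝ≥0∞) * 1 := by gcongr
    _ = N := mul_one _

/-- **`L²`-Lipschitz continuity of the condensate occupation** in the form
`|n₀(Φ) - n₀(Ψ)| ≤ 2N ‖Φ - Ψ‖_{L²(Λ^N)}` for continuous `Φ, Ψ` in the unit ball of `L²(Λ^N)`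
(`n₀ = N‖PΨ‖²` with `P` the one-particle constant-mode projection, a contraction).
[cite: LSSY2005, App. A (A.11), (A.13)] -/
theorem abs_toReal_condensateOccupation_sub_le {N : ℕ} (hL : 0 < L) {Φ Ψ : Config N → ℂ}
    (hΦ : Continuous Φ) (hΨ : Continuous Ψ)
    (hΦ1 : ∫⁻ X in cellN N L, (‖Φ X‖₊ : ℝ≥0∞) ^ 2 ≤ 1)
    (hΨ1 : ∫⁻ X in cellN N L, (‖Ψ X‖₊ : ℝ≥0∞) ^ 2 ≤ 1) :
    |(condensateOccupation N L Φ).toReal - (condensateOccupation N L Ψ).toReal| ≤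
      2 * N * Real.sqrt (∫ X in cellN N L, ‖Φ X - Ψ X‖ ^ 2) := by
  set η : ℝ := ∫ X in cellN N L, ‖Φ X - Ψ X‖ ^ 2 with hηdef
  have hR : 0 ≤ 2 * N * Real.sqrt η := by positivity
  have hΦfin := condensateOccupation_ne_top_of_lintegral_le_one hL hΦ hΦ1
  have hΨfin := condensateOccupation_ne_top_of_lintegral_le_one hL hΨ hΨ1
  have h1 := condensateOccupation_le_add_of_sq_dist_le hL hΦ hΨ hΦ1 hΨ1 (le_refl η)
  have hη' : ∫ X in cellN N L, ‖Ψ X - Φ X‖ ^ 2 ≤ η := by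
    refine le_of_eq (hηdef ▸ integral_congr_ae (ae_of_all _ fun X => ?_))
    simp only [norm_sub_rev]
  have h2 := condensateOccupation_le_add_of_sq_dist_le hL hΨ hΦ hΨ1 hΦ1 hη'
  rw [abs_sub_le_iff]
  constructor
  · have := ENNReal.toReal_mono (ENNReal.add_ne_top.2 ⟨hΨfin, ENNReal.ofReal_ne_top⟩) h1
    rw [ENNReal.toReal_add hΨfin ENNReal.ofReal_ne_top, ENNReal.toReal_ofReal hR] at this
    linarith
  · have := ENNReal.toReal_mono (ENNReal.add_ne_top.2 ⟨hΦfin, ENNReal.ofReal_ne_top⟩) h2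
    rw [ENNReal.toReal_add hΦfin ENNReal.ofReal_ne_top, ENNReal.toReal_ofReal hR] at this
    linarith

/-- **Trial-state form, modulo a phase**: for periodic trial states `Φ, Ψ` with
`∫_{Λ^N} |Φ - e^{iθ}Ψ|² ≤ η`, `n₀(Ψ) ≤ n₀(Φ) + 2N√η` (phase invariance + Lipschitz continuity).
[cite: Fournais2020, (1.3)–(1.5)] -/
theorem PeriodicTrialState.condensateOccupation_le_add_of_phase_sq_dist_le {N : ℕ} (hL : 0 < L)
    (Φ Ψ : PeriodicTrialState N L) {θ η : ℝ}
    (h : ∫ X in cellN N L, ‖Φ.ψ X - Complex.exp (θ * Complex.I) * Ψ.ψ X‖ ^ 2 ≤ η) :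
    condensateOccupation N L Ψ.ψ ≤ condensateOccupation N L Φ.ψ + ENNReal.ofReal (2 * N * Real.sqrt η) := by
  have hΨ' : Continuous fun X => Complex.exp (θ * Complex.I) * Ψ.ψ X :=
    continuous_const.mul Ψ.contDiff.continuous
  have hΨ'1 : ∫⁻ X in cellN N L, (‖Complex.exp (θ * Complex.I) * Ψ.ψ X‖₊ : ℝ≥0∞) ^ 2 ≤ 1 := by
    simp only [coe_nnnorm_mul_sq, coe_nnnorm_exp_mul_I_sq, one_mul]
    exact Ψ.norm_eq.le
  have hη' : ∫ X in cellN N L, ‖Complex.exp (θ * Complex.I) * Ψ.ψ X - Φ.ψ X‖ ^ 2 ≤ η := by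
    refine le_trans (le_of_eq (integral_congr_ae (ae_of_all _ fun X => ?_))) h
    simp only [norm_sub_rev]
  have hmain := BoseGas.condensateOccupation_le_add_of_sq_dist_le hL hΨ' Φ.contDiff.continuous hΨ'1
    Φ.norm_eq.le hη'
  rwa [condensateOccupation_phase_mul] at hmain

end Lipschitz

/-! ### Transfer of condensation to near-minimisers under variational simplicity -/

section Transfer

variable {N : ℕ} {L : ℝ}

/-- `ofReal ((c - ε) N) + ofReal (ε N) ≤ n ⇒ …`: the bookkeeping `ofReal (cN) ≤ n + ofReal (εN)` implies
`ofReal ((c - ε)N) ≤ n`. [folklore] -/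
theorem ofReal_sub_mul_le_of_le_add {c ε : ℝ} (hε : 0 ≤ ε) (N : ℕ) {n : ℝ≥0∞}
    (h : ENNReal.ofReal (c * N) ≤ n + ENNReal.ofReal (ε * N)) :
    ENNReal.ofReal ((c - ε) * N) ≤ n := by
  rcases le_or_gt ((c - ε) * N) 0 with hneg | hpos
  · rw [ENNReal.ofReal_of_nonpos hneg]
    exact bot_le
  · refine ENNReal.le_of_add_le_add_right ENNReal.ofReal_ne_top (h.trans' (le_of_eq ?_))
    rw [← ENNReal.ofReal_add hpos.le (by positivity)]
    congr 1
    ring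

/-- **Condensation of near-minimisers from variational simplicity** (fixed `N`, `L`). Hypotheses:
(clustering, Cauchy form) for every `η > 0` there is `δ > 0` such that any two `δ`-near-minimisers
`Φ, Φ'` of the periodic energy satisfy `∫_{Λ^N}|Φ - e^{iθ}Φ'|² ≤ η` for some phase `θ`; and at
every slack `δ > 0` some `δ`-near-minimiser has `n₀ ≥ cN`. Conclusion: for every `ε > 0` there is
`δ > 0` such that EVERY `δ`-near-minimiser has `n₀ ≥ (c - ε)N`. Proof: clustering with
`η = (ε/2)²`, phase invariance and the `2N√η` Lipschitz bound. [folklore] -/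
theorem le_condensateOccupation_nearMinimiser_of_clustering (hL : 0 < L) (v : ℝ → ℝ≥0∞)
    (hcl : ∀ η : ℝ, 0 < η → ∃ δ : ℝ≥0∞, 0 < δ ∧ ∀ Φ Φ' : PeriodicTrialState N L,
        periodicEnergy v Φ ≤ periodicGroundStateEnergy v N L + δ →
        periodicEnergy v Φ' ≤ periodicGroundStateEnergy v N L + δ →
        ∃ θ : ℝ, ∫ X in cellN N L, ‖Φ.ψ X - Complex.exp (θ * Complex.I) * Φ'.ψ X‖ ^ 2 ≤ η)
    {c : ℝ}
    (hocc : ∀ δ : ℝ≥0∞, 0 < δ → ∃ Ψ : PeriodicTrialState N L,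
        periodicEnergy v Ψ ≤ periodicGroundStateEnergy v N L + δ ∧
        ENNReal.ofReal (c * N) ≤ condensateOccupation N L Ψ.ψ)
    {ε : ℝ} (hε : 0 < ε) :
    ∃ δ : ℝ≥0∞, 0 < δ ∧ ∀ Φ : PeriodicTrialState N L,
      periodicEnergy v Φ ≤ periodicGroundStateEnergy v N L + δ →
      ENNReal.ofReal ((c - ε) * N) ≤ condensateOccupation N L Φ.ψ := by
  obtain ⟨δ, hδ, hclδ⟩ := hcl ((ε / 2) ^ 2) (by positivity)
  refine ⟨δ, hδ, fun Φ hΦ => ?_⟩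
  obtain ⟨Ψ, hΨE, hΨocc⟩ := hocc δ hδ
  obtain ⟨θ, hθ⟩ := hclδ Φ Ψ hΦ hΨE
  have hlip := PeriodicTrialState.condensateOccupation_le_add_of_phase_sq_dist_le hL Φ Ψ hθ
  rw [Real.sqrt_sq (by positivity)] at hlip
  refine ofReal_sub_mul_le_of_le_add hε.le N (hΨocc.trans (hlip.trans (le_of_eq ?_)))
  congr 2
  ring

/-- **Condensation of near-minimisers from a condensed minimiser** under variational simplicity:
if a minimiser `Ψ` has `n₀(Ψ) ≥ cN` and near-minimisers cluster modulo a phase, then for every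
`ε > 0` all `δ`-near-minimisers (some `δ > 0`) have `n₀ ≥ (c - ε)N`. [folklore] -/
theorem le_condensateOccupation_nearMinimiser_of_minimiser (hL : 0 < L) (v : ℝ → ℝ≥0∞)
    (hcl : ∀ η : ℝ, 0 < η → ∃ δ : ℝ≥0∞, 0 < δ ∧ ∀ Φ Φ' : PeriodicTrialState N L,
        periodicEnergy v Φ ≤ periodicGroundStateEnergy v N L + δ →
        periodicEnergy v Φ' ≤ periodicGroundStateEnergy v N L + δ →
        ∃ θ : ℝ, ∫ X in cellN N L, ‖Φ.ψ X - Complex.exp (θ * Complex.I) * Φ'.ψ X‖ ^ 2 ≤ η)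
    {c : ℝ} (Ψ : PeriodicTrialState N L)
    (hΨmin : periodicEnergy v Ψ = periodicGroundStateEnergy v N L)
    (hΨocc : ENNReal.ofReal (c * N) ≤ condensateOccupation N L Ψ.ψ) {ε : ℝ} (hε : 0 < ε) :
    ∃ δ : ℝ≥0∞, 0 < δ ∧ ∀ Φ : PeriodicTrialState N L,
      periodicEnergy v Φ ≤ periodicGroundStateEnergy v N L + δ →
      ENNReal.ofReal ((c - ε) * N) ≤ condensateOccupation N L Φ.ψ :=
  le_condensateOccupation_nearMinimiser_of_clustering hL v hcl
    (fun _ _ => ⟨Ψ, hΨmin.le.trans le_self_add, hΨocc⟩) hε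

/-- **Truncation transfer for a BOUNDED potential.** For bounded `v` the truncation `min(v, n)` is
`v` itself once `n ≥ sup v`, so condensed minimisers of the truncations are condensed minimisers of
`v`, and variational simplicity transfers `n₀ ≥ cN` to `n₀ ≥ (c - ε)N` for all `δ`-near-minimisers
of `v`. (For unbounded `v` the same conclusion needs compactness on the torus and monotone
convergence of the closed forms.) [folklore] -/
theorem truncationTransfer_of_bounded (v : ℝ → ℝ≥0∞) (hbdd : ∃ M : ℝ≥0∞, M ≠ ⊤ ∧ ∀ r, v r ≤ M)
    (N : ℕ) (L : ℝ) (hL : 0 < L)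
    (hcl : ∀ η : ℝ, 0 < η → ∃ δ : ℝ≥0∞, 0 < δ ∧ ∀ Φ Φ' : PeriodicTrialState N L,
        periodicEnergy v Φ ≤ periodicGroundStateEnergy v N L + δ →
        periodicEnergy v Φ' ≤ periodicGroundStateEnergy v N L + δ →
        ∃ θ : ℝ, ∫ X in cellN N L, ‖Φ.ψ X - Complex.exp (θ * Complex.I) * Φ'.ψ X‖ ^ 2 ≤ η)
    (c : ℝ)
    (hmin : ∀ n : ℕ, ∃ Ψ : PeriodicTrialState N L,
        periodicEnergy (fun r => min (v r) (n : ℝ≥0∞)) Ψ =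
          periodicGroundStateEnergy (fun r => min (v r) (n : ℝ≥0∞)) N L ∧
        ENNReal.ofReal (c * N) ≤ condensateOccupation N L Ψ.ψ)
    (ε : ℝ) (hε : 0 < ε) :
    ∃ δ : ℝ≥0∞, 0 < δ ∧ ∀ Φ : PeriodicTrialState N L,
      periodicEnergy v Φ ≤ periodicGroundStateEnergy v N L + δ →
      ENNReal.ofReal ((c - ε) * N) ≤ condensateOccupation N L Φ.ψ := by
  obtain ⟨M, hM, hvM⟩ := hbdd
  obtain ⟨n, hn⟩ := ENNReal.exists_nat_gt hM
  have hv : (fun r => min (v r) (n : ℝ≥0∞)) = v :=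
    funext fun r => min_eq_left ((hvM r).trans hn.le)
  obtain ⟨Ψ, hΨmin, hΨocc⟩ := hmin n
  rw [hv] at hΨmin
  exact le_condensateOccupation_nearMinimiser_of_minimiser hL v hcl Ψ hΨmin hΨocc hε

end Transfer

end Literature.MathematicalPhysics.QuantumManyBody.BoseGas
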